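import Summits.BirchSwinnertonDyer.BirchSwinnertonDyer.Theses.AdditiveBranchIMC
import Summits.BirchSwinnertonDyer.Rank1Residual.Additive.LocalTowerKernelAtPTwistedOrdinaryClasses
import Summits.BirchSwinnertonDyer.Rank1Residual.Additive.LocalTowerKernelAtPTwistedOrdinaryTwo
import Summits.BirchSwinnertonDyer.Rank1Residual.Additive.GordRankZeroChiBranch
import Summits.BirchSwinnertonDyer.Rank1Residual.Additive.TypeGThree
import Summits.BirchSwinnertonDyer.Rank1Residual.Additive.StrictSignedSelmerPreimageZeroPadic
import Summits.BirchSwinnertonDyer.Rank1Residual.Iwasawa.SelmerCardOfLevelZeroControlTamagawa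
import Literature.NumberTheory.EllipticCurves.IwasawaTowerTorsionFiniteProofs
import Literature.NumberTheory.EllipticCurves.LeadingTermPPartProofs
import Literature.NumberTheory.EllipticCurves.PAdicBSDKatoFiniteProofs
import Literature.NumberTheory.EllipticCurves.IwasawaLeadingTermProofs
import HarnessLib

/-!
# K1 route `AdditiveBranchIMC` — `ReadingFacts` child RF-5 `DelbourgoPotGoodOrdUnit`
# (item stmt-BirchSwinnertonDyer-19300): Delbourgo 1998 Thm. 3 + Prop. 4 in the exact unit form at an
# additive potentially good ORDINARY prime, REDUCED in the kernel to Greenberg's control-diagram count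
# (Lemma 4.7, Cassels–Poitou–Tate) and the local Tamagawa orders away from `p` (Lemma 3.3)

Cell `bsd-addord` (home `run/shared/lean/pub/bsd-addord/`), inputs seat `bsd-inputs-abimc-rf-p2`
(director-bsd g13 (172)(f′); pen = planner g28, REQUESTS l.30191 (C)). HONEST FRAMING: nothing here
proves the Birch–Swinnerton-Dyer conjecture, the crux `ReadingFacts` (19361) or the reading fact
`DelbourgoPotGoodOrdUnit := Literature.…Delbourgo1998.prop4_rankZero_constantCoeff_eq_unit_mul_of_potGoodOrd`;
BSD is not proved by any of this. THEOREMS ONLY: no `def`, no named fact, no `sorry`; the two printed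
inputs that the tree does not prove enter as EXPLICIT HYPOTHESES spelled inline (`h47`, `h33` of §3).

## The item (verbatim shape) and the port

`prop4_rankZero_constantCoeff_eq_unit_mul_of_potGoodOrd`: for `W/ℚ` globally minimal elliptic, `p ≠ 2`
ADDITIVE with Delbourgo's (G)-ordinary hypothesis (`= Addv W p ∧ TypeGOrd W p` of the cell, verbatim),
`r_an = 0`, `Ш(E)`, `E(ℚ)` finite, `κ` cyclotomic with topological generator `γ`, `v ∋ p`, any dual
datum `D`: (1) `X(E/ℚ_∞)` is `Λ`-torsion, (2) `𝒦_{v,0}[p^∞]` (the `p`-power torsion of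
`ker (H¹(ℚ_v, E) → H¹(ℚ_vℚ_∞, E))`, Delbourgo's `#H¹(ℚ_{∞,𝔭}/ℚ_p, E(ℚ_{∞,𝔭}))`) is finite, (3)
`g(0) · #E(ℚ)² = u · #Ш(E)(p) · #𝒦_{v,0}[p^∞] · ∏_{ν ≠ p} c_ν` for a generator `g` of `char X` and `u ∈ ℤ_pˣ`.

What the TREE proves (assembled here): Greenberg's Lemmas 4.2 × 4.3 for every `E/ℚ` and `ℤ_p`-extension
(`SelmerDualData.constantCoeff_charGenerator_mul_natCard_of_finite_selmerGroup_rat`: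
`f(0)·#(Sel_∞)_Γ·#E[p^∞]^{Γ_ℚ} = u·#Sel_{p^∞}(E/ℚ)·#ker g_0`, `X` torsion once `Sel_{p^∞}(E/ℚ)`, `ker g_0`
are finite); `ker g_0` finite from local finiteness (Lemmas 3.3, 3.5); `𝒦_{v,0}[p^∞] = ⊥` AT the
additive (G)-ordinary `v ∋ p` on the WHOLE locus (§1: the cell's good-model theorems, `e = 2` via the
`p*`-twist — automatic at `p = 3` — and `e ∈ {3,4,6}`, `p ≥ 5`), so conjuncts (1)–(2) are PROVED
(`isTorsion_and_finite_localTowerKerPrimary_of_typeGOrd_of_addv`) and the intrinsic factor is `1`;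
`#Sel_{p^∞}(E/ℚ) = #Ш(E)(p)` in rank `0`; `#E(ℚ)(p) = #E[p^∞]^{Γ_ℚ}` (§0) and unit bookkeeping (§2).
DISPLAYED (§3; both printed, neither in the tree): `h47` — Greenberg's control-diagram count
`#ker g_0·#E[p^∞]^{Γ_ℚ} = #(Sel_∞)_Γ·∏_{w∈S} #𝒦_{w,0}[p^∞]` (LNM 1716 Lemmas 4.5–4.7, pp. 104–108:
Cassels–Poitou–Tate, surjectivity of the localisation over `F_∞`, `H¹(F_Σ/F_∞, E[p^∞])_Γ = 0`; at an
additive (G)-ordinary `p` = steps (i)–(iii) of Delbourgo's proof of Prop. 4, p. 147, with "`δ` is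
surjective", p. 148) — the ONE global-duality input; `h33` — the local orders `#𝒦_{w,0}[p^∞] = c_w^{(p)}`
at `w ∤ p` for the cyclotomic tower (Greenberg Lemma 3.3 and p. 88; Delbourgo §2.2 Lemma, `ν ≠ p`); the
tree proves `≤` (`natCard_localTowerKerPrimary_zero_le_pow_padicValNat_localTamagawaNumber`).

SIZE VERDICT (2026-08-28): RF-5 as typed = (tree) + `h47` + `h33`; `h33` is M (X11b's coinvariant count
`AcSelmer.index_range_decompSubOne_eq_pow` + inflation–restriction in the n1011 currency); `h47` is L
(Cassels–Poitou–Tate for `E[p^∞]` over `ℚ` and `ℚ_∞`; the tree has only the finite-module Poitou–Tate).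

References: [Delbourgo1998] Compositio Math. 113 (1998), §1.5 p. 130, §2.2 p. 138, Thm. 3 p. 143,
Prop. 4 p. 144, pp. 147–148; [GreenbergLNM1716] LNM 1716 (1999), §3 Lemmas 3.3–3.5, 3.4/Prop. 3.8, §4
Thm. 4.1, Lemmas 4.2–4.7 (pp. 102–108).
-/

set_option autoImplicit false
-- the problem directory `BirchSwinnertonDyer/BirchSwinnertonDyer` forces a duplicated namespace component
set_option linter.dupNamespace false

noncomputable section

open scoped Classical NumberField

universe u

namespace Summit.BirchSwinnertonDyer.BirchSwinnertonDyer.Theorems.AdditiveBranchIMCDelbourgoPotGoodOrdUnit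

open NumberField IsDedekindDomain Field WeierstrassCurve
open Literature.NumberTheory.EllipticCurves Literature.NumberTheory.EllipticCurves.IwasawaDual
  Literature.NumberTheory.GaloisRepresentations
  Literature.NumberTheory.EllipticCurves.Rank1Residual
open Summit.BirchSwinnertonDyer.Rank1Residual.Additive
open Summit.BirchSwinnertonDyer.Rank1Residual.Iwasawa
open Summit.BirchSwinnertonDyer.BirchSwinnertonDyer.Theses.AdditiveBranchIMC

/-! ## §0 `#E(K)(p) = #E[p^∞]^{Γ_K}` and `#E(K)² = u · (#E[p^∞]^{Γ_K})²` in `ℤ_p` -/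

section RationalTorsion

variable {K : Type u} [Field K] [NumberField K] (W : WeierstrassCurve K) (p : ℕ) [hp : Fact p.Prime]

omit [NumberField K] hp in
/-- **Galois descent for the `p`-power torsion: `E(K)(p) ≃ E[p^∞]^{Γ_K}`, counted.** The
`Γ_K`-fixed points of `E[p^∞] = E(K̄)[p^∞]` are exactly the images of the `K`-rational points of
`p`-power order (`exists_toGeomPoints_eq_of_forall_smul_eq`, `toGeomPoints_injective`). Greenberg's
"`|E(F)_p|`" (LNM 1716, Lemma 4.3 and Thm. 4.1). [cite: GreenbergLNM1716, §4 Lemma 4.3 (p. 103)] -/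
theorem natCard_fixedPoints_geomPrimaryTorsion_eq_natCard_primaryComponent [PerfectField K] :
    Nat.card (MulAction.fixedPoints (Field.absoluteGaloisGroup K) (geomPrimaryTorsion W p)) =
      Nat.card (AddCommGroup.primaryComponent W.toAffine.Point p) := by
  let ι : AddCommGroup.primaryComponent W.toAffine.Point p →
      MulAction.fixedPoints (Field.absoluteGaloisGroup K) (geomPrimaryTorsion W p) :=
    fun P ↦ ⟨⟨toGeomPoints W (P : W.toAffine.Point), by
        obtain ⟨k, hk⟩ := P.2
        exact ⟨k, by rw [← map_nsmul, hk, map_zero]⟩⟩,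
      fun σ ↦ Subtype.ext (by
        rw [primaryComponent.coe_smul]
        exact smul_toGeomPoints W σ P)⟩
  refine (Nat.card_congr (Equiv.ofBijective ι ⟨?_, ?_⟩)).symm
  · intro P Q h
    have h' := congrArg (fun x ↦ ((x.1 : geomPrimaryTorsion W p) : geomPoints W)) h
    exact Subtype.ext (toGeomPoints_injective W h')
  · rintro ⟨m, hm⟩
    have hfix : ∀ σ : Field.absoluteGaloisGroup K, σ • (m : geomPoints W) = m := fun σ ↦ by
      rw [← primaryComponent.coe_smul, hm σ]
    obtain ⟨P, hP⟩ := exists_toGeomPoints_eq_of_forall_smul_eq W hfix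
    obtain ⟨k, hk⟩ := m.2
    refine ⟨⟨P, k, ?_⟩, Subtype.ext (Subtype.ext hP)⟩
    apply toGeomPoints_injective W
    rw [map_nsmul, hP, map_zero]
    exact hk

/-- **`#E(K)² = u · (#E[p^∞]^{Γ_K})²` in `ℤ_p`, `u ∈ ℤ_pˣ`**, for `E(K)` finite: `#E(K) = #E(K)(p) · m`
with `p ∤ m` (`exists_card_eq_card_primaryComponent_mul_not_dvd`) and `#E(K)(p) = #E[p^∞]^{Γ_K}`.
[cite: GreenbergLNM1716, §4 Thm. 4.1 (p. 102)] -/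
theorem exists_unit_natCard_point_sq_eq [Finite W.toAffine.Point] :
    ∃ u : ℤ_[p]ˣ, ((Nat.card W.toAffine.Point : ℕ) : ℤ_[p]) ^ 2 =
      (u : ℤ_[p]) *
        ((Nat.card (MulAction.fixedPoints (Field.absoluteGaloisGroup K) (geomPrimaryTorsion W p)) :
          ℕ) : ℤ_[p]) ^ 2 := by
  obtain ⟨m, hm, hcard⟩ := exists_card_eq_card_primaryComponent_mul_not_dvd W.toAffine.Point p
  have hu : IsUnit (m : ℤ_[p]) :=
    PadicInt.isUnit_iff.mpr (PadicInt.norm_natCast_eq_one_iff.mpr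
      ((Nat.Prime.coprime_iff_not_dvd hp.out).mpr hm))
  refine ⟨hu.unit ^ 2, ?_⟩
  rw [hcard, natCard_fixedPoints_geomPrimaryTorsion_eq_natCard_primaryComponent W p, Units.val_pow_eq_pow_val,
    IsUnit.unit_spec]
  push_cast
  ring

end RationalTorsion

/-! ## §1 The local factor at the additive (G)-ordinary prime is `1`: `𝒦_{v,0}[p^∞] = ⊥` -/

section LocalFactor

variable (W : WeierstrassCurve ℚ) [W.IsGloballyMinimal] [W.IsElliptic] (p : ℕ) [hp : Fact p.Prime]

/-- **`𝒦_{v,0}[p^∞] = ⊥` at the additive (G)-ordinary place `v ∋ p`, `p` odd, for EVERY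
`ℤ_p`-extension `κ` of `ℚ`** — the cell's Lemma-3.4-type theorems assembled over Delbourgo's whole
locus `TypeGOrd W p ∧ Addv W p` (= the hypotheses of `DelbourgoPotGoodOrdUnit`, verbatim): on the
`e = 2` rows (all rows at `p = 3`, `semistabilityIndex_eq_two_of_typeG_three`) through the good ordinary
`p*`-twist model (`TypeGOrd.exists_goodOrd_pStar_twist_model`,
`GoodModelLine.localTowerKerPrimary_zero_eq_bot_of_goodOrd_twist`), on the `e ∈ {3,4,6}` rows
(`p ≥ 5`) by `GoodModelLine.localTowerKerPrimary_zero_eq_bot_of_typeGOrd_of_semistabilityIndex_ne_two`.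
So the intrinsic factor `#H¹(ℚ_{∞,𝔭}/ℚ_p, E(ℚ_{∞,𝔭}))(p)` of Delbourgo's Prop. 4 (read on p. 138 as
the `𝔭`-component of `Ker(δ)`) is `1` on the (G)-ordinary locus — NOT §2.2 Lemma (i)'s value
`#𝔉(𝔽_p)(p)·#ℜ` on the anomalous rows (the dispute note of the Literature file).
[cite: GreenbergLNM1716, §3 Lemma 3.4 (p. 89) and Prop. 3.8 (p. 95)]
[cite: Delbourgo1998, Prop. 4 (p. 144) with §2.2 p. 138] -/
theorem localTowerKerPrimary_zero_eq_bot_of_typeGOrd_of_addv (hp2 : p ≠ 2) (hG : TypeGOrd W p)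
    (hadd : Addv W p) {v : HeightOneSpectrum (𝓞 ℚ)} (hpv : ((p : ℕ) : 𝓞 ℚ) ∈ v.asIdeal)
    (κ : ZpExtension ℚ p) :
    W.localTowerKerPrimary κ (v.adicCompletion ℚ) 0 = ⊥ := by
  by_cases he : semistabilityIndex W p = 2
  · obtain ⟨V, _, _, C, hV, hC⟩ := TypeGOrd.exists_goodOrd_pStar_twist_model W p hp2 hG hadd he
    have haddv : W.HasAdditiveReductionAt v := by
      rw [GoodModelLine.eq_primesEquiv_symm p hpv]
      exact hasAdditiveReductionAt_of_addv W p hadd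
    exact GoodModelLine.localTowerKerPrimary_zero_eq_bot_of_goodOrd_twist W p hpv hp2 V
      (pStar_ne_zero p) C hC hV haddv κ
  · have hp3 : p ≠ 3 := by
      rintro rfl
      exact he (semistabilityIndex_eq_two_of_typeG_three W hG.typeG hadd)
    have hp5 : 5 ≤ p := hp.out.five_le_of_ne_two_of_ne_three hp2 hp3
    exact GoodModelLine.localTowerKerPrimary_zero_eq_bot_of_typeGOrd_of_semistabilityIndex_ne_two W p
      hp5 hG hadd he hpv κ

/-- Hence that factor is FINITE of order `1`. [cite: Delbourgo1998, Prop. 4 (p. 144), p. 147 (iii)] -/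
theorem natCard_localTowerKerPrimary_zero_eq_one_of_typeGOrd_of_addv (hp2 : p ≠ 2)
    (hG : TypeGOrd W p) (hadd : Addv W p) {v : HeightOneSpectrum (𝓞 ℚ)}
    (hpv : ((p : ℕ) : 𝓞 ℚ) ∈ v.asIdeal) (κ : ZpExtension ℚ p) :
    Finite (W.localTowerKerPrimary κ (v.adicCompletion ℚ) 0) ∧
      Nat.card (W.localTowerKerPrimary κ (v.adicCompletion ℚ) 0) = 1 := by
  rw [localTowerKerPrimary_zero_eq_bot_of_typeGOrd_of_addv W p hp2 hG hadd hpv κ]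
  exact ⟨inferInstance, AddSubgroup.card_bot⟩

end LocalFactor

/-! ## §2 Units of `ℤ_p`: `n = u · p^{ord_p n}` and products -/

section Units

variable (p : ℕ) [hp : Fact p.Prime]

/-- `n = u · p^{ord_p n}` in `ℤ_p` with `u ∈ ℤ_pˣ`, for `n ≠ 0`. [folklore] -/
theorem exists_unit_natCast_eq_mul_pow {n : ℕ} (hn : n ≠ 0) :
    ∃ u : ℤ_[p]ˣ, (n : ℤ_[p]) = (u : ℤ_[p]) * ((p ^ padicValNat p n : ℕ) : ℤ_[p]) := by
  have hsplit : ordProj[p] n * ordCompl[p] n = n := Nat.ordProj_mul_ordCompl_eq_self n p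
  have hproj : ordProj[p] n = p ^ padicValNat p n := by rw [Nat.factorization_def n hp.out]
  have hcompl : ¬ p ∣ ordCompl[p] n := Nat.not_dvd_ordCompl hp.out hn
  have hu : IsUnit ((ordCompl[p] n : ℕ) : ℤ_[p]) :=
    PadicInt.isUnit_iff.mpr (PadicInt.norm_natCast_eq_one_iff.mpr
      ((Nat.Prime.coprime_iff_not_dvd hp.out).mpr hcompl))
  refine ⟨hu.unit, ?_⟩
  rw [IsUnit.unit_spec, ← hproj]
  conv_lhs => rw [← hsplit]
  push_cast
  ring

/-- `∏ g i = U · ∏ p^{ord_p (g i)}` in `ℤ_p` with `U ∈ ℤ_pˣ`, for non-zero naturals `g i`. [folklore] -/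
theorem exists_unit_natCast_prod_eq_mul_prod_pow {ι : Type*} (s : Finset ι) (g : ι → ℕ)
    (hg : ∀ i ∈ s, g i ≠ 0) :
    ∃ U : ℤ_[p]ˣ, ((∏ i ∈ s, g i : ℕ) : ℤ_[p]) =
      (U : ℤ_[p]) * ((∏ i ∈ s, p ^ padicValNat p (g i) : ℕ) : ℤ_[p]) := by
  induction s using Finset.cons_induction with
  | empty => exact ⟨1, by simp⟩
  | cons a s ha ih =>
    obtain ⟨U, hU⟩ := ih fun i hi ↦ hg i (Finset.mem_cons_of_mem hi)
    obtain ⟨u, hu⟩ := exists_unit_natCast_eq_mul_pow p (hg a (Finset.mem_cons_self a s))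
    refine ⟨u * U, ?_⟩
    rw [Finset.prod_cons, Finset.prod_cons, Nat.cast_mul, Nat.cast_mul, hU, hu, Units.val_mul]
    ring

end Units

/-! ## §3 The door: `DelbourgoPotGoodOrdUnit` from the control-diagram count and the local orders -/

section Door

/-- **Conjuncts (1) and (2) of RF-5 PROVED OUTRIGHT: Delbourgo 1998 Thm. 3 on the (G)-ordinary locus
(with (Kol)'s conclusions as binders) and the finiteness of the `p`-factor.** For `W/ℚ` globally minimal
elliptic, `p ≠ 2` additive (G)-ordinary, `Ш(E)` and `E(ℚ)` finite, ANY `ℤ_p`-extension `κ` with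
topological generator `γ`, `v ∋ p`, any dual datum `D`: `X(E/ℚ_∞)` is `Λ`-torsion and `𝒦_{v,0}[p^∞]` is
finite (indeed trivial, §1). Proof: `Sel_{p^∞}(E/ℚ)` is finite (rank `0`), `ker g_0` is finite by the
local finiteness at every place (`𝒦_{w,0}[p^∞]` finite at `w ∤ p`, `= ⊥` at `w ∣ p`), and Mazur's control
at level `0` (`isTorsion_of_finite_selmerGroup_of_finite_kerG`, inside the tree's Thm-4.1 skeleton).
Unconditional; no analytic input. [cite: Delbourgo1998, Thm. 3 (p. 143) and p. 147 (iii)]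
[cite: GreenbergLNM1716, §1 Thm. 1.4, §3 Lemmas 3.3–3.5] -/
theorem isTorsion_and_finite_localTowerKerPrimary_of_typeGOrd_of_addv
    (W : WeierstrassCurve ℚ) [W.IsElliptic] [W.IsGloballyMinimal] (p : ℕ) [Fact p.Prime]
    (hp2 : p ≠ 2) (hadd : Addv W p) (hG : TypeGOrd W p) [Finite W.sha] [Finite W.toAffine.Point]
    (κ : ZpExtension ℚ p) {γ : Field.absoluteGaloisGroup ℚ} (hγ : κ.IsTopGenerator γ)
    {v : HeightOneSpectrum (𝓞 ℚ)} (hpv : ((p : ℕ) : 𝓞 ℚ) ∈ v.asIdeal) (D : W.SelmerDualData κ γ) :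
    D.IsTorsion ∧ Finite (W.localTowerKerPrimary κ (v.adicCompletion ℚ) 0) := by
  have hbot : ∀ {w : HeightOneSpectrum (𝓞 ℚ)}, ((p : ℕ) : 𝓞 ℚ) ∈ w.asIdeal →
      W.localTowerKerPrimary κ (w.adicCompletion ℚ) 0 = ⊥ := fun hpw ↦
    localTowerKerPrimary_zero_eq_bot_of_typeGOrd_of_addv W p hp2 hG hadd hpw κ
  have hSel : Finite (W.selmerGroupPInfty p) := W.finite_selmerGroupPInfty_of_finite_primaryComponent p
  obtain ⟨S, hS⟩ := exists_finset_forall_not_mem_good W p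
  have hSfin : ∀ w ∈ S, Finite (W.localTowerKerPrimary κ (w.adicCompletion ℚ) 0) := by
    intro w _
    by_cases hpw : ((p : ℕ) : 𝓞 ℚ) ∈ w.asIdeal
    · rw [hbot hpw]; infer_instance
    · exact W.finite_localTowerKerPrimary_zero_of_not_mem κ hpw
  obtain ⟨hg, -⟩ := finite_kerG_zero_and_natCard_dvd_prod_of_good W κ S hSfin hS
  obtain ⟨f, hf⟩ := (charIdeal_isPrincipal_holds p D.X).principal
  have hf' : Module.charIdeal (IwasawaAlgebra p) D.X = Ideal.span {f} := hf
  obtain ⟨-, hX, -⟩ :=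
    D.constantCoeff_charGenerator_mul_natCard_of_finite_selmerGroup_rat W hγ hSel hg f hf'
  exact ⟨hX, (natCard_localTowerKerPrimary_zero_eq_one_of_typeGOrd_of_addv W p hp2 hG hadd hpv κ).1⟩

/-- **RF-5 (item 19300) REDUCED to the control-diagram count and the local Tamagawa orders.**
`DelbourgoPotGoodOrdUnit` follows from the tree (Greenberg's Lemmas 4.2 × 4.3, Mazur's control at level
`0`, `𝒦_{v,0}[p^∞] = ⊥` on the locus (§1), `Sel_{p^∞}(E/ℚ) ≅ Ш(E)(p)` in rank `0`,
`#E(ℚ)(p) = #E[p^∞]^{Γ_ℚ}` (§0)) and EXACTLY TWO displayed printed inputs, spelled inline: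
`h47` — the control-diagram count `#ker g_0 · #E[p^∞]^{Γ_ℚ} = #(Sel_∞)_Γ · ∏_{w ∈ S} #𝒦_{w,0}[p^∞]`
(`S ⊇ {bad} ∪ {p}` finite; `ker g_0 = WeierstrassCurve.KerG`, `(Sel_∞)_Γ = EndCoinvariants (conj_γ − 1)`)
on Delbourgo's locus with `Sel_{p^∞}(E/ℚ)` finite — Greenberg's Lemma 4.7 with Lemmas 4.5–4.6
(Cassels–Poitou–Tate `P_E(F)/G_E(F) ≅ E(F)_p^∨`, surjectivity at the infinite level,
`H¹(F_Σ/F_∞, E[p^∞])_Γ = 0`; LNM 1716 pp. 104–108; = Delbourgo's proof of Prop. 4, p. 147 (i)–(iii) and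
p. 148 "`δ` is surjective", at an additive (G)-ordinary `p`), the ONE global-duality input; `h33` — the
local orders `#𝒦_{w,0}[p^∞] = c_w^{(p)}` at `w ∤ p` for the cyclotomic `ℤ_p`-extension (Greenberg Lemma
3.3, p. 88; Delbourgo §2.2 Lemma `ν ≠ p`, p. 138; the tree has `≤` and the good case). CONDITIONAL on
`h47`, `h33` (displayed; credits nothing); closes nothing by itself; BSD is not proved by any of this.
[cite: Delbourgo1998, Thm. 3 (p. 143), Prop. 4 (p. 144) and its proof pp. 147–148]
[cite: GreenbergLNM1716, §4 Thm. 4.1, Lemmas 4.2–4.7 (pp. 102–108); §3 Lemma 3.3 (pp. 86–88)] -/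
theorem delbourgoPotGoodOrdUnit_of_controlCount_of_localOrders
    (h47 : ∀ (W : WeierstrassCurve ℚ) [W.IsElliptic] [W.IsGloballyMinimal] (p : ℕ) [Fact p.Prime],
      p ≠ 2 → Addv W p → TypeGOrd W p → Finite (W.selmerGroupPInfty p) →
      ∀ (κ : ZpExtension ℚ p) (γ : Field.absoluteGaloisGroup ℚ), κ.IsCyclotomic → κ.IsTopGenerator γ →
      ∀ S : Finset (HeightOneSpectrum (𝓞 ℚ)),
        (∀ w ∉ S, ((p : ℕ) : 𝓞 ℚ) ∉ w.asIdeal ∧ W.HasGoodReductionAt w) →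
        (∀ w ∈ S, Finite (W.localTowerKerPrimary κ (w.adicCompletion ℚ) 0)) →
        Finite (EndCoinvariants (W.conjSelmerInfty κ γ - 1)) →
        Nat.card (W.KerG κ 0) *
            Nat.card (MulAction.fixedPoints (Field.absoluteGaloisGroup ℚ) (W.geomPrimaryTorsion p)) =
          Nat.card (EndCoinvariants (W.conjSelmerInfty κ γ - 1)) *
            ∏ w ∈ S, Nat.card (W.localTowerKerPrimary κ (w.adicCompletion ℚ) 0))
    (h33 : ∀ (W : WeierstrassCurve ℚ) [W.IsElliptic] [W.IsGloballyMinimal] (p : ℕ) [Fact p.Prime]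
      (κ : ZpExtension ℚ p), p ≠ 2 → κ.IsCyclotomic →
      ∀ w : HeightOneSpectrum (𝓞 ℚ), ((p : ℕ) : 𝓞 ℚ) ∉ w.asIdeal →
        Nat.card (W.localTowerKerPrimary κ (w.adicCompletion ℚ) 0) =
          p ^ padicValNat p (W.tamagawaNumberAt w)) :
    DelbourgoPotGoodOrdUnit := by
  intro W _ _ p _ hp2 hadd hG hr hsha hE κ γ hκ hγ v hpv D
  have hp : Fact p.Prime := ‹_›
  haveI : Finite W.sha := hsha
  haveI : Finite W.toAffine.Point := hE
  have hadd' : Addv W p := hadd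
  have hG' : TypeGOrd W p := hG
  -- (1) the local factor at `p` is `1`
  have hbot : ∀ {w : HeightOneSpectrum (𝓞 ℚ)}, ((p : ℕ) : 𝓞 ℚ) ∈ w.asIdeal →
      W.localTowerKerPrimary κ (w.adicCompletion ℚ) 0 = ⊥ := fun hpw ↦
    localTowerKerPrimary_zero_eq_bot_of_typeGOrd_of_addv W p hp2 hG' hadd' hpw κ
  obtain ⟨hKvfin, hKv1⟩ :=
    natCard_localTowerKerPrimary_zero_eq_one_of_typeGOrd_of_addv W p hp2 hG' hadd' hpv κ
  -- (2) `Sel_{p^∞}(E/ℚ)` is finite of order `#Ш(E)(p)`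
  have hSel : Finite (W.selmerGroupPInfty p) := W.finite_selmerGroupPInfty_of_finite_primaryComponent p
  have hSelSha : Nat.card (W.selmerGroupPInfty p) =
      Nat.card (AddCommGroup.primaryComponent W.sha p) :=
    W.natCard_selmerGroupPInfty_eq_natCard_primaryComponent_sha p
  -- (3) a finite set of places off which everything is good and prime to `p`
  obtain ⟨S, hS⟩ := exists_finset_forall_not_mem_good W p
  have hSfin : ∀ w ∈ S, Finite (W.localTowerKerPrimary κ (w.adicCompletion ℚ) 0) := by
    intro w _
    by_cases hpw : ((p : ℕ) : 𝓞 ℚ) ∈ w.asIdeal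
    · rw [hbot hpw]; infer_instance
    · exact W.finite_localTowerKerPrimary_zero_of_not_mem κ hpw
  -- (4) `ker g_0` is finite (Mazur control at level 0, local finiteness)
  obtain ⟨hg, -⟩ := finite_kerG_zero_and_natCard_dvd_prod_of_good W κ S hSfin hS
  -- (5) a generator of the characteristic ideal
  obtain ⟨f, hf⟩ := (charIdeal_isPrincipal_holds p D.X).principal
  have hf' : Module.charIdeal (IwasawaAlgebra p) D.X = Ideal.span {f} := hf
  have hfD : D.charIdeal = Ideal.span {f} := hf
  -- (6) the Thm-4.1 skeleton (Greenberg's Lemmas 4.2 × 4.3)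
  obtain ⟨-, hX, -, hco, -, u, hu⟩ :=
    D.constantCoeff_charGenerator_mul_natCard_of_finite_selmerGroup_rat W hγ hSel hg f hf'
  -- (7) the displayed control-diagram count
  have h47' := h47 W p hp2 hadd' hG' hSel κ γ hκ hγ S hS hSfin hco
  -- abbreviations
  set F0 : ℤ_[p] := PowerSeries.constantCoeff f with hF0
  set C : ℕ := Nat.card (EndCoinvariants (W.conjSelmerInfty κ γ - 1)) with hC
  set X : ℕ := Nat.card (MulAction.fixedPoints (Field.absoluteGaloisGroup ℚ) (W.geomPrimaryTorsion p))
    with hXdef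
  set G : ℕ := Nat.card (W.KerG κ 0) with hGdef
  set P : ℕ := ∏ w ∈ S, Nat.card (W.localTowerKerPrimary κ (w.adicCompletion ℚ) 0) with hPdef
  set Sl : ℕ := Nat.card (W.selmerGroupPInfty p) with hSl
  -- (8) cancel `#(Sel_∞)_Γ`: `f(0) · X² = u · #Sel · P`
  have hC0 : (C : ℤ_[p]) ≠ 0 := by
    haveI := hco
    exact Nat.cast_ne_zero.mpr (Nat.card_pos (α := EndCoinvariants (W.conjSelmerInfty κ γ - 1))).ne'
  have hcore : F0 * (X : ℤ_[p]) ^ 2 = (u : ℤ_[p]) * Sl * P := by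
    have h1 : (C : ℤ_[p]) * (F0 * (X : ℤ_[p]) ^ 2) = (C : ℤ_[p]) * ((u : ℤ_[p]) * Sl * P) := by
      have h47z : ((G : ℤ_[p]) * X) = (C : ℤ_[p]) * P := by exact_mod_cast h47'
      calc (C : ℤ_[p]) * (F0 * (X : ℤ_[p]) ^ 2) = (F0 * C * X) * X := by ring
        _ = ((u : ℤ_[p]) * Sl * G) * X := by rw [hu]
        _ = (u : ℤ_[p]) * Sl * (G * X) := by ring
        _ = (u : ℤ_[p]) * Sl * (C * P) := by rw [h47z]
        _ = (C : ℤ_[p]) * ((u : ℤ_[p]) * Sl * P) := by ring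
    exact mul_left_cancel₀ hC0 h1
  -- (9) the local orders on `S`: `P = ∏_{w ∈ S, w ∤ p} p^{ord_p c_w}`
  have hP : P = ∏ w ∈ S, (if ((p : ℕ) : 𝓞 ℚ) ∈ w.asIdeal then 1
      else p ^ padicValNat p (W.tamagawaNumberAt w)) := by
    refine Finset.prod_congr rfl fun w _ ↦ ?_
    split_ifs with hpw
    · rw [hbot hpw]; exact AddSubgroup.card_bot
    · exact h33 W p κ hp2 hκ w hpw
  -- (10) the Tamagawa factor of the statement as a finite product, and its `p`-adic unit part
  have hT : (∏ᶠ w : HeightOneSpectrum (𝓞 ℚ),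
      (if ((p : ℕ) : 𝓞 ℚ) ∈ w.asIdeal then 1 else W.tamagawaNumberAt w)) =
      ∏ w ∈ S, (if ((p : ℕ) : 𝓞 ℚ) ∈ w.asIdeal then 1 else W.tamagawaNumberAt w) := by
    refine finprod_eq_prod_of_mulSupport_subset _ fun w hw ↦ ?_
    rw [Finset.mem_coe]
    by_contra hwS
    refine hw ?_
    show (if ((p : ℕ) : 𝓞 ℚ) ∈ w.asIdeal then 1 else W.tamagawaNumberAt w) = 1
    rw [if_neg (hS w hwS).1]
    exact W.localTamagawaNumber_eq_one_of_hasGoodReductionAt_holds w (hS w hwS).2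
  have hne : ∀ w ∈ S, (if ((p : ℕ) : 𝓞 ℚ) ∈ w.asIdeal then 1 else W.tamagawaNumberAt w) ≠ 0 := by
    intro w _
    split_ifs with hpw
    · exact one_ne_zero
    · exact W.localTamagawaNumber_baseChange_ne_zero w
  obtain ⟨U, hU⟩ := exists_unit_natCast_prod_eq_mul_prod_pow p S _ hne
  have hpow : (∏ w ∈ S, p ^ padicValNat p
      (if ((p : ℕ) : 𝓞 ℚ) ∈ w.asIdeal then 1 else W.tamagawaNumberAt w)) =
      ∏ w ∈ S, (if ((p : ℕ) : 𝓞 ℚ) ∈ w.asIdeal then 1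
        else p ^ padicValNat p (W.tamagawaNumberAt w)) := by
    refine Finset.prod_congr rfl fun w _ ↦ ?_
    split_ifs with hpw
    · rw [padicValNat_one_right, pow_zero]
    · rfl
  -- (11) `#E(ℚ)² = u' · X²`
  obtain ⟨u', hu'⟩ := exists_unit_natCard_point_sq_eq W p
  -- (12) assemble
  refine ⟨hX, hKvfin, f, by rw [hfD]; exact Ideal.mem_span_singleton_self f, hfD,
    u' * u * U⁻¹, ?_⟩
  rw [hKv1, hT, hu', ← hSelSha, Nat.cast_one, mul_one, hU, hpow, ← hP]
  calc F0 * ((u' : ℤ_[p]) * (X : ℤ_[p]) ^ 2) = (u' : ℤ_[p]) * (F0 * (X : ℤ_[p]) ^ 2) := by ring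
    _ = (u' : ℤ_[p]) * ((u : ℤ_[p]) * Sl * P) := by rw [hcore]
    _ = ((u' * u * U⁻¹ : ℤ_[p]ˣ) : ℤ_[p]) * Sl * ((U : ℤ_[p]) * P) := by
      rw [Units.val_mul, Units.val_mul]
      calc (u' : ℤ_[p]) * ((u : ℤ_[p]) * Sl * P)
          = (u' : ℤ_[p]) * (u : ℤ_[p]) * ((U⁻¹ : ℤ_[p]ˣ) * (U : ℤ_[p]ˣ) : ℤ_[p]ˣ) * Sl * P := by
            rw [inv_mul_cancel, Units.val_one]; ring
        _ = (u' : ℤ_[p]) * (u : ℤ_[p]) * ((U⁻¹ : ℤ_[p]ˣ) : ℤ_[p]) * Sl * ((U : ℤ_[p]) * P) := by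
            rw [Units.val_mul]; ring

end Door

end Summit.BirchSwinnertonDyer.BirchSwinnertonDyer.Theorems.AdditiveBranchIMCDelbourgoPotGoodOrdUnit

end
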